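import Summits.NavierStokesRegularity.NavierStokesRegularity.Theses.ExtremiserTransience
import Summits.NavierStokesRegularity.NavierStokesRegularity.Theorems.ExtremiserTransiencePerFlowScaleLock
import HarnessLib.Audit

/-!
# Crux `NearExtremalTransience` (stmt-NavierStokesRegularity-21883) — LINE «gevrey_slack» (ns-idea-10 g4, lens «rescuer»)

TARGET DECIDED BY THIS SKELETON (by name, kernel-checked composition `NearExtremalTransiencePerFlow_of` below):
`Theses.ExtremiserTransience.NearExtremalTransiencePerFlow` (stmt-26567) — the PER-FLOW near-extremal transience that the
route's deciding theorem `closes (hT : NearExtremalTransiencePerFlow) (hC : DepletionCascade) (hII : NoTypeII) (hA : AveragedRung)`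
actually consumes.  The UNIVERSAL-θ ceiling-lift statement `NearExtremalTransience` (21883, this directory's crux) implies 26567 by
instantiation and is NOT reached by this line (see «HONEST LIMIT» below: the mechanism is per-flow by nature).  No summit is proved
by a line; Navier–Stokes regularity is NOT proved by anything here.

THE DEATH DODGED (rescuer).  Recorded death of the ET family: «universal-constant depletion improvements — κ⋆ is SHARP on the static
admissible class V, so no constant-form input lifts the ceiling» (birth.md M1; HANDOFF ns-idea-10 g0) and «global clock comparison
gives only θ(C)» (M3).  Dodge, as ONE explicit crux: cut the static class by a DYNAMIC a-priori property that every Navier–Stokes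
slice has and a generic admissible field has not — UNIFORM REAL-ANALYTICITY (Gevrey–Cauchy bounds) AT THE SCALE OF ITS OWN
DISSIPATION LENGTH λ = √(Z/P) — and claim the sharp constant is NOT sharp on the cut class (`stub_gevreyDepletionGap`).  The tree
already proves the qualitative germ: an ATTAINER of κ⋆ in V has a speed plateau `{|v| = M}` with non-empty interior and is
real-analytic on NO neighbourhood of a free-boundary point (`KStar.interior_contact_nonempty`, `KStar.not_attained_of_analyticOnNhd`,
`KStar.exists_nonanalytic_point`); the stub is its QUANTITATIVE form (efficiency of (σ,K)-Gevrey fields ≤ θ₁(σ,K)·κ⋆, θ₁ < 1).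
θ(C) is ACCEPTED: the conclusion is per flow, which is all `closes` needs.

MECHANISM (composition, no extraction, no ancient solutions, no homogeneous class — the actual L² slices of the flow are used):
suppose a Type-I singular flow violates the per-flow conclusion.  LANDED (ns-idea-5 g4, tree): at a non-null set of late times the
slice is (κ⋆−ε)-efficient AND scale-locked, `c₁ν(T−t)P ≤ Z ≤ c₂ν(T−t)P` (`PerFlow.scaleLock_at_nearEfficient_times`), and Leray's
lower rate `c₀√ν ≤ √(T−t)·sup|u(t)|` holds (`PerFlow.lerayLowerRate_of_not_extends`).  STUB A (in print: Guberović 2010,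
Kukavica 1999, Grujić–Kukavica 1998 + Cauchy estimates + the Type-I window): late Type-I slices obey the Gevrey–Cauchy bounds
`‖Dⁿu(t)‖_∞ ρ(t)ⁿ ≤ K₀ (C√ν/√(T−t)) n!` with radius `ρ(t) = c₀'√(ν(T−t))/C`.  At a locked time `ρ ≥ σλ` with `σ = c₀'/(C√c₂)` and,
by Leray, `K₀C√ν/√(T−t) ≤ (K₀C/c₀)·sup|u(t)|`: the slice lies in the (σ,K)-Gevrey class RELATIVE TO ITS OWN amplitude and
dissipation length, so STUB B caps its efficiency at θ₁κ⋆ < (κ⋆ − ε) for ε = (1−θ₁)κ⋆/2 — contradiction.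

HONEST LIMIT.  σ, K — hence θ₁ and the flow's exponent θ_u — depend on the Type-I level C (σ ~ 1/C, K ~ C): the line proves
26567 (∃θ after the flow), not 21883 (θ before C).  It cannot do better: θ₁(σ,K) → 1 as σ → 0 or K → ∞ (mollified plateau
fields), and a large-C flow may be efficient at log-most times with sub-maximal growth (x = √(P/Z)·ν/(κ⋆M) ≪ 1).

Conventions: stubs are `theorem stub_… := by sorry` (the ONLY sorries); the composition has no binders and no sorry.
References: Z. Grujić, I. Kukavica, J. Funct. Anal. 152 (1998) 447–466, Thm 2.1 [corpus: paper:doi-10-1006-jfan-1997-3167 p.3];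
R. Guberović, Discrete Contin. Dyn. Syst. 27 (2010) 231–236; I. Kukavica, Indiana Univ. Math. J. 48 (1999) 1057–1081;
Z. Bradshaw, A. Farhat, Z. Grujić, ARMA 231 (2019), §2 Thm 10 [corpus: paper:arxiv-1704.05546 p.7–8]; C. Foias, R. Temam,
J. Funct. Anal. 87 (1989) 359–369; J. Leray, Acta Math. 63 (1934) §19; tree: `KStar.not_attained_of_analyticOnNhd`,
`PerFlow.scaleLock_at_nearEfficient_times`, `PerFlow.lerayLowerRate_of_not_extends`, `DepletionLadder.sharpDepletion_gt`.
-/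

noncomputable section

open Set MeasureTheory Filter Topology
open scoped InnerProductSpace RealInnerProductSpace ENNReal
open Literature.Analysis.FluidPDE

namespace Summit.NavierStokesRegularity.NavierStokesRegularity.Cruxes.NearExtremalTransience.GevreySlack

open Summit.NavierStokesRegularity.NavierStokesRegularity.Theses.ExtremiserTransience
open Summit.NavierStokesRegularity.NavierStokesRegularity.Theorems
open Summit.NavierStokesRegularity.NavierStokesRegularity.Theorems.DepletionLadder

set_option linter.unusedVariables false
set_option linter.dupNamespace false
set_option linter.style.longLine false

/-- **stub A (DYNAMIC INPUT, in print; rank 3, size M — a port).** GEVREY–CAUCHY RADIUS OF TYPE-I SLICES: absolute `c₀, K₀ > 0`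
such that every classical Leray–Hopf rapidly-decaying-datum flow on `[0,T)` with eventual Type-I rate `√(T−t)‖u(t)‖_∞ ≤ C√ν` has,
for all late `t`, all orders `n` and all `x`, `‖Dⁿu(t)(x)‖ · (c₀√ν√(T−t)/C)ⁿ ≤ K₀ · (C√ν/√(T−t)) · n!`.
Proof route (print): start Guberović's / Kukavica's `L^∞` analytic smoothing at `s₀ = t − c(T−t)/C²` (admissible since
`‖u(s₀)‖_∞ ≤ C√ν/√(T−s₀)`), which gives a holomorphic extension to the strip `|Im z| < c'√(ν(t−s₀))` bounded by `K‖u(s₀)‖_∞`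
(Guberović 2010; Grujić–Kukavica 1998 Thm 2.1 for `L^p`; Bradshaw–Farhat–Grujić 2019 Thm 10 for the vorticity form), identify it
with `u` by local uniqueness in the bounded class (Kukavica 2003), and convert strip bounds into Cauchy estimates for `Dⁿu(t)`.
Why it might fail: it should not — absolute constants throughout; the only bookkeeping is the polarisation constant `eⁿ` and the
polydisc-in-strip factor `√3ⁿ`, absorbed in `c₀`. [sources: Guberovic2010, Kukavica1999, GrujicKukavica1998 (paper:doi-10-1006-jfan-1997-3167
p.3 Thm 2.1), arXiv:1704.05546 §2, FoiasTemam1989] -/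
theorem stub_typeI_gevreyRadius :
    ∃ c₀ K₀ : ℝ, 0 < c₀ ∧ 0 < K₀ ∧ ∀ (C ν T : ℝ), 0 < C → 0 < ν → 0 < T →
      ∀ (u : ℝ → EuclideanSpace ℝ (Fin 3) → EuclideanSpace ℝ (Fin 3)) (p : ℝ → EuclideanSpace ℝ (Fin 3) → ℝ),
        IsClassicalNSSolutionOn (Set.Ico 0 T) ν 0 u p → IsLerayHopfOn T ν 0 (u 0) u → HasRapidSpatialDecay (u 0) →
        (∀ᶠ t in 𝓝[<] T, ∀ x, Real.sqrt (T - t) * ‖u t x‖ ≤ C * Real.sqrt ν) →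
        ∀ᶠ t in 𝓝[<] T, ∀ (n : ℕ) (x : EuclideanSpace ℝ (Fin 3)),
          ‖iteratedFDeriv ℝ n (u t) x‖ * (c₀ * Real.sqrt ν * Real.sqrt (T - t) / C) ^ n ≤
            K₀ * (C * Real.sqrt ν / Real.sqrt (T - t)) * (n.factorial : ℝ) := by
  sorry

/-- **stub B (THE EXPLICIT NEW CRUX, rank 2, size L/XL).** GEVREY DEPLETION GAP — the sharp constant is NOT sharp on uniformly
analytic fields: for every `σ > 0`, `K > 0` there is `θ₁ < 1` such that every admissible field of the tree's class V (`C^∞`,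
divergence free, `|v| ≤ M`, `Dv` bounded, `D⁰v, D¹v, D²v ∈ L²`) obeying the Gevrey–Cauchy bounds AT THE SCALE OF ITS OWN
DISSIPATION LENGTH `λ = ‖ω‖₂/‖∇ω‖₂` and RELATIVE TO ITS OWN AMPLITUDE, `‖Dⁿv‖_∞ (σλ)ⁿ ≤ K·M·n!` for all `n` (written
multiplicatively: `‖Dⁿv(x)‖·(σ‖ω‖₂)ⁿ ≤ K M n! ‖∇ω‖₂ⁿ`), has depleted stretching `|∫⟪ω, Dv ω⟫| ≤ θ₁·κ⋆·M·‖ω‖₂·‖∇ω‖₂`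
(`κ⋆ = sInf V`, the tree's literal).  Qualitative germ in tree: no real-analytic ATTAINER (`KStar.not_attained_of_analyticOnNhd`:
an attainer has an open speed plateau).  Proof route: M-λ-normalised maximising sequences in the (σ,K)-class are precompact in
`C^k_loc` (Cauchy bounds); rule out VANISHING/SPREADING (single-bump selection: `R` of far-apart pieces ≤ max of the pieces since
`J, Z, P` add and `M` is common) so that a subsequence converges, with `J, Z, P` converging, to an attainer IN the class — which is
analytic, contradiction.  Why it might fail: a maximising sequence for κ⋆ may stay uniformly Gevrey by SPREADING (expanding
single-scale quasi-periodic patterns `w_n` with `R_per[w_n] → κ⋆`; trigonometric patterns are Gevrey-uniform with `K = e^{O(σ)}`),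
i.e. κ⋆ approached without plateau formation — then θ₁(σ,K) = 1 for large K and the stub is false. [sources: tree
ExtremiserTransienceKStarAttainedContact.lean (`KStar.not_attained_of_analyticOnNhd`, `interior_contact_nonempty`),
ExtremiserTransienceKStarAttainedSingularSet.lean; LuDoering2008; AyalaProtas2017; KangYunProtas2020; FoiasTemam1989; Lions 1984
(concentration-compactness I, Ann. IHP Anal. Non Lin. 1, 109–145)]
rev 1.1 (critic idea-crit-8 V39, prices P2/P3).  REDUCTION: normalise M = 1, λ = 1; the (σ,K)-class is precompact in every C^k_loc and
dichotomy never pays (R(far union) ≤ max R(pieces): √(Z₁+Z₂)√(P₁+P₂) ≥ √Z₁√P₁ + √Z₂√P₂), so B ⇔ B1 ∧ B2 with B1 = «no ATTAINER of κ⋆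
inside the (σ,K)-class» — TRUE IN TREE (`KStar.not_attained_of_analyticOnNhd`) — and B2 = «the MEAN efficiency of bounded, uniformly
analytic, NON-L² limit patterns of budget (σ,K) (bounded real-analytic divergence-free fields with Besicovitch means ⟨ω·Sω⟩, ⟨|ω|²⟩,
⟨|∇ω|²⟩ along the exhausting balls; invariantly: |ω|²-twisted stationary laws on the Gevrey hull, cf. LINE «campbell_extremiser») stays
< κ⋆».  B2 IS THE ENTIRE OPEN CONTENT; route (iii) «bump selection» of rev 1 is WITHDRAWN (void at the level of suprema: copy-invariance
+ truncation give sup over patterns = κ⋆; instrument I-GS1, `Lines/gevrey_slack_igs1.md`).  JUNK CORNERS: K < 1 ⇒ trivially true with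
θ₁ = K (n = 0 forces sup|v| ≤ KM); ‖ω‖₂ = 0 or ‖∇ω‖₂ = 0 ⇒ v bounded harmonic and L² ⇒ v = 0 ⇒ 0 ≤ 0.  BUDGET: the composition uses
(σ,K) = (c_G/(C√c₂(C)), K_G C/c_L), monotone in the Type-I level C, so θ_u degrades exactly through θ₁(σ(C),K(C)) → 1 as C → ∞. -/
theorem stub_gevreyDepletionGap :
    ∀ σ K : ℝ, 0 < σ → 0 < K → ∃ θ₁ : ℝ, θ₁ < 1 ∧
      ∀ (v : EuclideanSpace ℝ (Fin 3) → EuclideanSpace ℝ (Fin 3)) (M : ℝ),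
        ContDiff ℝ (⊤ : ℕ∞) v → VectorCalculus.IsDivFree v → (∀ x, ‖v x‖ ≤ M) → (∃ B : ℝ, ∀ x, ‖fderiv ℝ v x‖ ≤ B) →
        (∫⁻ x, ‖iteratedFDeriv ℝ 0 v x‖ₑ ^ 2 < ⊤) → (∫⁻ x, ‖iteratedFDeriv ℝ 1 v x‖ₑ ^ 2 < ⊤) →
        (∫⁻ x, ‖iteratedFDeriv ℝ 2 v x‖ₑ ^ 2 < ⊤) →
        (∀ (n : ℕ) (x : EuclideanSpace ℝ (Fin 3)),
          ‖iteratedFDeriv ℝ n v x‖ * (σ * Real.sqrt (∫ y, ‖curl v y‖ ^ 2)) ^ n ≤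
            K * M * (n.factorial : ℝ) * (Real.sqrt (∫ y, frobeniusNormSq (fderiv ℝ (curl v) y))) ^ n) →
        |∫ x, ⟪curl v x, fderiv ℝ v x (curl v x)⟫_ℝ| ≤
          θ₁ * sInf {κ : ℝ | (∀ (v : EuclideanSpace ℝ (Fin 3) → EuclideanSpace ℝ (Fin 3)) (M B : ℝ), ContDiff ℝ (⊤ : ℕ∞) v → Literature.Analysis.FluidPDE.VectorCalculus.IsDivFree v → (∀ x, ‖v x‖ ≤ M) → (∀ x, ‖fderiv ℝ v x‖ ≤ B) → (∫⁻ x, ‖iteratedFDeriv ℝ 0 v x‖ₑ ^ 2 < ⊤) → (∫⁻ x, ‖iteratedFDeriv ℝ 1 v x‖ₑ ^ 2 < ⊤) → (∫⁻ x, ‖iteratedFDeriv ℝ 2 v x‖ₑ ^ 2 < ⊤) → |∫ x, ⟪Literature.Analysis.FluidPDE.curl v x, fderiv ℝ v x (Literature.Analysis.FluidPDE.curl v x)⟫_ℝ| ≤ κ * M * Real.sqrt (∫ x, ‖Literature.Analysis.FluidPDE.curl v x‖ ^ 2) * Real.sqrt (∫ x, Literature.Analysis.FluidPDE.frobeniusNormSq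 (fderiv ℝ (Literature.Analysis.FluidPDE.curl v) x)))}
            * M * Real.sqrt (∫ x, ‖curl v x‖ ^ 2) * Real.sqrt (∫ x, frobeniusNormSq (fderiv ℝ (curl v) x)) := by
  sorry

/-- **COMPOSITION (kernel-checked, no sorry, no binders): stub A + stub B ⟹ `NearExtremalTransiencePerFlow` (stmt-26567) BY NAME.**
The landed per-flow scale lock and Leray's lower rate put a near-efficient late slice of a violating Type-I singular flow inside the
(σ,K)-Gevrey class relative to its own amplitude and dissipation length (σ = c₀/(C√c₂), K = K₀C/c₀'), where stub B caps the
efficiency strictly below the near-efficiency the lock provides. [folklore] -/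
theorem NearExtremalTransiencePerFlow_of : NearExtremalTransiencePerFlow := by
  intro C ν T hC hν hT u p hsol hLH hdec hrate hext
  by_contra hnot
  -- landed (ns-idea-5 g4): two-sided scale lock at near-efficient late times of a violating flow
  obtain ⟨c₁, c₂, hc₁, hc₁₂, hlock⟩ := PerFlow.scaleLock_at_nearEfficient_times hC hν hT hsol hLH hdec hrate hext hnot
  -- landed: Leray's lower amplitude rate
  obtain ⟨cL, hcL, hler⟩ := PerFlow.lerayLowerRate_of_not_extends hν hT hsol hLH hdec hext
  -- stub A: Gevrey–Cauchy radius of late Type-I slices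
  obtain ⟨cG, KG, hcG, hKG, hgev⟩ := stub_typeI_gevreyRadius
  obtain ⟨a, haT, hsub⟩ := mem_nhdsLT_iff_exists_Ioo_subset.1 (hgev C ν T hC hν hT u p hsol hLH hdec hrate)
  have haT' : a < T := haT
  have hc₂ : 0 < c₂ := lt_of_lt_of_le hc₁ hc₁₂
  -- the Gevrey parameters of locked slices (they depend on the Type-I level `C`: the line is per-flow)
  set σ : ℝ := cG / (C * Real.sqrt c₂) with hσ
  set K : ℝ := KG * C / cL with hK
  have hσpos : 0 < σ := by rw [hσ]; positivity
  have hKpos : 0 < K := by rw [hK]; positivity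
  -- stub B: the gap
  obtain ⟨θ₁, hθ₁, hgap⟩ := stub_gevreyDepletionGap σ K hσpos hKpos
  set κs : ℝ := sInf {κ : ℝ | (∀ (v : EuclideanSpace ℝ (Fin 3) → EuclideanSpace ℝ (Fin 3)) (M B : ℝ), ContDiff ℝ (⊤ : ℕ∞) v → Literature.Analysis.FluidPDE.VectorCalculus.IsDivFree v → (∀ x, ‖v x‖ ≤ M) → (∀ x, ‖fderiv ℝ v x‖ ≤ B) → (∫⁻ x, ‖iteratedFDeriv ℝ 0 v x‖ₑ ^ 2 < ⊤) → (∫⁻ x, ‖iteratedFDeriv ℝ 1 v x‖ₑ ^ 2 < ⊤) → (∫⁻ x, ‖iteratedFDeriv ℝ 2 v x‖ₑ ^ 2 < ⊤) → |∫ x, ⟪Literature.Analysis.FluidPDE.curl v x, fderiv ℝ v x (Literature.Analysis.FluidPDE.curl v x)⟫_ℝ| ≤ κ * M * Real.sqrt (∫ x, ‖Literature.Analysis.FluidPDE.curl v x‖ ^ 2) * Real.sqrt (∫ x, Literature.Analysis.FluidPDE.frobeniusNormSq (fderiv ℝ (Literature.Analysis.FluidPDE.curl v) x)))} with hκs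
  have hκpos : 0 < κs := lt_trans (by norm_num) sharpDepletion_gt
  set ε : ℝ := (1 - θ₁) / 2 * κs with hε
  have hεpos : 0 < ε := by rw [hε]; exact mul_pos (by linarith) hκpos
  -- a late onset past the Gevrey onset `a`
  set t₁ : ℝ := max ((a + T) / 2) (T / 2) with ht₁
  have ht₁T : t₁ < T := max_lt (by linarith) (by linarith)
  have ht₁0 : 0 ≤ t₁ := le_trans (by linarith) (le_max_right _ _)
  have hat₁ : a < t₁ := lt_of_lt_of_le (by linarith : a < (a + T) / 2) (le_max_left _ _)
  -- a locked, near-efficient time `t ∈ [t₁, T)` exists (the set is non-null, hence nonempty)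
  obtain ⟨t, htI, hlow, hup, hv, hdiv, hB, h1, h2, M, hM, hpos, heff⟩ :=
    nonempty_of_measure_ne_zero (hlock ε hεpos t₁ ⟨ht₁0, ht₁T⟩)
  have htT : t ∈ Set.Ico 0 T := ⟨ht₁0.trans htI.1, htI.2⟩
  have hTt : 0 < T - t := sub_pos.2 htI.2
  have hsT : 0 < Real.sqrt (T - t) := Real.sqrt_pos.2 hTt
  have hsν : 0 < Real.sqrt ν := Real.sqrt_pos.2 hν
  -- the slice is in `L²` (all Sobolev seminorms of a slice are finite; Tao 2013 Cor. 11.1 in tree)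
  have h0 : ∫⁻ x, ‖iteratedFDeriv ℝ 0 (u t) x‖ₑ ^ 2 < ⊤ :=
    EnstrophyBudget.sobolev_slice (EnstrophyBudget.isLocalSolution hν hT hsol hLH hdec) htT 0
  -- abbreviations
  set Zt : ℝ := ∫ x, ‖curl (u t) x‖ ^ 2 with hZt
  set Pt : ℝ := ∫ x, frobeniusNormSq (fderiv ℝ (curl (u t)) x) with hPt
  have hZ0 : 0 ≤ Zt := integral_nonneg fun x => sq_nonneg _
  have hP0 : 0 ≤ Pt := integral_nonneg fun x => frobeniusNormSq_nonneg _
  -- `M > 0` and Leray: `cL √ν ≤ √(T−t) · M`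
  have hMpos : 0 < M := by
    rcases (le_trans (norm_nonneg _) (hM 0)).eq_or_lt with h | h
    · rw [← h, zero_mul, zero_mul] at hpos; exact absurd hpos (lt_irrefl _)
    · exact h
  obtain ⟨x₀, hx₀⟩ := hler t htT
  have hLer : cL * Real.sqrt ν ≤ Real.sqrt (T - t) * M :=
    hx₀.trans (mul_le_mul_of_nonneg_left (hM x₀) hsT.le)
  -- Gevrey–Cauchy bounds at `t` (stub A), radius `ρ`, constant `A`
  set ρ : ℝ := cG * Real.sqrt ν * Real.sqrt (T - t) / C with hρ
  have hρ0 : 0 ≤ ρ := by rw [hρ]; positivity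
  have hA : ∀ (n : ℕ) (x : EuclideanSpace ℝ (Fin 3)),
      ‖iteratedFDeriv ℝ n (u t) x‖ * ρ ^ n ≤ KG * (C * Real.sqrt ν / Real.sqrt (T - t)) * (n.factorial : ℝ) :=
    hsub ⟨hat₁.trans_le htI.1, htI.2⟩
  -- (i) the lock makes the radius at least `σλ`:  `σ √Z ≤ ρ √P`
  have hσZ : σ * Real.sqrt Zt ≤ ρ * Real.sqrt Pt := by
    have h1' : Real.sqrt Zt ≤ Real.sqrt (c₂ * (ν * (T - t)) * Pt) := Real.sqrt_le_sqrt hup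
    have h2' : Real.sqrt (c₂ * (ν * (T - t)) * Pt) =
        Real.sqrt c₂ * Real.sqrt ν * Real.sqrt (T - t) * Real.sqrt Pt := by
      rw [Real.sqrt_mul (by positivity), Real.sqrt_mul hc₂.le, Real.sqrt_mul hν.le]; ring
    have hc2s : 0 < Real.sqrt c₂ := Real.sqrt_pos.2 hc₂
    calc σ * Real.sqrt Zt ≤ σ * (Real.sqrt c₂ * Real.sqrt ν * Real.sqrt (T - t) * Real.sqrt Pt) :=
          mul_le_mul_of_nonneg_left (h1'.trans_eq h2') hσpos.le
      _ = ρ * Real.sqrt Pt := by rw [hσ, hρ]; field_simp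
  -- (ii) Leray makes the Gevrey constant at most `K·M`
  have hKM : KG * (C * Real.sqrt ν / Real.sqrt (T - t)) ≤ K * M := by
    have hq : Real.sqrt ν / Real.sqrt (T - t) ≤ M / cL := by
      rw [div_le_div_iff₀ hsT hcL]
      calc Real.sqrt ν * cL = cL * Real.sqrt ν := mul_comm _ _
        _ ≤ Real.sqrt (T - t) * M := hLer
        _ = M * Real.sqrt (T - t) := mul_comm _ _
    calc KG * (C * Real.sqrt ν / Real.sqrt (T - t)) = (KG * C) * (Real.sqrt ν / Real.sqrt (T - t)) := by ring
      _ ≤ (KG * C) * (M / cL) := mul_le_mul_of_nonneg_left hq (by positivity)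
      _ = K * M := by rw [hK]; field_simp
  -- (iii) hence the slice is in the (σ,K)-Gevrey class relative to its own `M` and `λ`
  have hG : ∀ (n : ℕ) (x : EuclideanSpace ℝ (Fin 3)),
      ‖iteratedFDeriv ℝ n (u t) x‖ * (σ * Real.sqrt Zt) ^ n ≤
        K * M * (n.factorial : ℝ) * (Real.sqrt Pt) ^ n := by
    intro n x
    have hD0 : 0 ≤ ‖iteratedFDeriv ℝ n (u t) x‖ := norm_nonneg _
    have hpow : (σ * Real.sqrt Zt) ^ n ≤ (ρ * Real.sqrt Pt) ^ n :=
      pow_le_pow_left₀ (by positivity) hσZ n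
    have hfac : (0 : ℝ) ≤ (n.factorial : ℝ) := by positivity
    have hsP : 0 ≤ (Real.sqrt Pt) ^ n := by positivity
    calc ‖iteratedFDeriv ℝ n (u t) x‖ * (σ * Real.sqrt Zt) ^ n
        ≤ ‖iteratedFDeriv ℝ n (u t) x‖ * (ρ * Real.sqrt Pt) ^ n := mul_le_mul_of_nonneg_left hpow hD0
      _ = (‖iteratedFDeriv ℝ n (u t) x‖ * ρ ^ n) * (Real.sqrt Pt) ^ n := by rw [mul_pow]; ring
      _ ≤ (KG * (C * Real.sqrt ν / Real.sqrt (T - t)) * (n.factorial : ℝ)) * (Real.sqrt Pt) ^ n :=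
          mul_le_mul_of_nonneg_right (hA n x) hsP
      _ ≤ (K * M * (n.factorial : ℝ)) * (Real.sqrt Pt) ^ n :=
          mul_le_mul_of_nonneg_right (mul_le_mul_of_nonneg_right hKM hfac) hsP
      _ = K * M * (n.factorial : ℝ) * (Real.sqrt Pt) ^ n := by ring
  -- stub B caps the efficiency of the slice at `θ₁ κ⋆`
  have hJle := hgap (u t) M hv hdiv hM hB h0 h1 h2 hG
  -- but the slice is `(κ⋆ − ε)`-efficient with `κ⋆ − ε > θ₁ κ⋆` and `M √Z √P > 0`
  have hcmp : (κs - ε) * (M * Real.sqrt Zt * Real.sqrt Pt) ≤ θ₁ * κs * (M * Real.sqrt Zt * Real.sqrt Pt) := by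
    have := heff.trans hJle
    have e1 : (κs - ε) * M * Real.sqrt Zt * Real.sqrt Pt = (κs - ε) * (M * Real.sqrt Zt * Real.sqrt Pt) := by ring
    have e2 : θ₁ * κs * M * Real.sqrt Zt * Real.sqrt Pt = θ₁ * κs * (M * Real.sqrt Zt * Real.sqrt Pt) := by ring
    rw [e1, e2] at this
    exact this
  have hle : κs - ε ≤ θ₁ * κs := le_of_mul_le_mul_right hcmp hpos
  have : κs - ε - θ₁ * κs = (1 - θ₁) / 2 * κs := by rw [hε]; ring
  nlinarith [mul_pos (by linarith : (0 : ℝ) < (1 - θ₁) / 2) hκpos]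

end Summit.NavierStokesRegularity.NavierStokesRegularity.Cruxes.NearExtremalTransience.GevreySlack

end
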